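import Summits.Ventures.HodgeRepro.Night1ReducedLevelK
import Summits.Ventures.HodgeRepro.Night1DivisorialWedge

/-!
# The reduced lines of a face are exceptional on the reduced product `B_red`: the Hodge classes Lemma R
hands to closer C5′ are not polynomials in divisor classes

Blind re-derivation cell `pub-hodge-repro`, seat `night-1` (gen 5, ninth file).  Imports night-1's
`Night1ReducedLevelK` (gen 3, p376815: the enumeration `reducedEnum cls tw e σ` of the reduced set `U_σ`,
`reducedEnum_injective`, `image_reducedEnum`) and `Night1DivisorialWedge` (the criterion
`coordWedgeOn_mem_divisorPowerIn_iff`: a coordinate wedge is a `k`-fold product of divisor classes iff its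
index set is a disjoint union of balanced pairs) and, through the chain, typer's `FaceReduce` (`corner`,
`reducedSet`) and gen 0's `FaceData`.

Route C (ROUTE.md §4 item 1, Lemma R) does not work on the full corner product `B = ∏_i A_{T i}` but on the
REDUCED product `B_red = ∏_j Simple(Φ_j)` (one simple factor per isogeny class `j ∈ J`, CM algebra `F^J`,
embeddings `J × G`): the `σ`-line of `W_F(B)` is carried to the coordinate wedge of the reduced set
`U_σ = {(cls i, σ · tw_i⁻¹) : i}` (gen 3's `Night1ProductLineReduce`), a Hodge class of `B_red` in
codimension `|ι|/2`, and C5′ has to make THAT class algebraic through BMM Cor 2 on a ball quotient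
dominating `B_red`.  This file checks on the kernel that the class is exceptional on `B_red` — no
polynomial in divisor classes of `B_red` equals it — so the Lefschetz `(1, 1)` theorem does not reach it
and the transfer from the ball quotient is genuinely needed:

* `eq_compl_of_balanced_pair_reduced` — a balanced pair of `U_σ` comes from two COMPLEMENTARY corners
  `Φ_{cls i'} · tw_{i'} = (Φ_{cls i} · tw_i)ᶜ`;
* **`coordWedgeOn_reducedEnum_notMem_divisorPowerIn`** — if no two corners are complementary, the
  reduced wedge `e_{U_σ}` is NOT a `k`-fold product of divisor classes of `B_red` (`k ≥ 1`);
* **`FaceData.reduced_exceptional`** — for every face record passing its checks in degree `> 4`, hence for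
  all 114 sealed census faces.

Nothing geometric is built; every statement is about coordinate wedges on the finite `G`-set `J × G`.
Nothing here says anything about the status of the Hodge conjecture for CM abelian varieties, which is
NOT proved.
-/

set_option autoImplicit false

open Finset Module
open scoped Pointwise

namespace HodgeRepro.RouteC

open CMHodgeOn

section Reduced

variable {G : Type*} [Group G] [DecidableEq G] [Fintype G] {ι J : Type*} [Fintype ι] [DecidableEq ι]
  [Fintype J] [DecidableEq J]

omit [Fintype ι] [DecidableEq ι] in
/-- **A balanced pair of the reduced set comes from complementary corners**: if the pair
`{(cls i, σ tw_i⁻¹), (cls i', σ tw_{i'}⁻¹)}` has exactly one point in `prodTypeSet (g • Φ)` for every `g`,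
then `Φ_{cls i'} · tw_{i'} = (Φ_{cls i} · tw_i)ᶜ`. -/
theorem eq_compl_of_balanced_pair_reduced (Φ : J → Finset G) (cls : ι → J) (tw : ι → G) (σ : G)
    {i i' : ι} (hne : (cls i, σ * (tw i)⁻¹) ≠ (cls i', σ * (tw i')⁻¹))
    (hbal : ∀ g : G, (univ.image (fun b : Fin 2 => ![(cls i, σ * (tw i)⁻¹), (cls i', σ * (tw i')⁻¹)] b) ∩
      prodTypeSet fun j => g • Φ j).card = 1) :
    corner Φ cls tw i' = (corner Φ cls tw i)ᶜ := by
  have hinj : Function.Injective fun b : Fin 2 =>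
      ![(cls i, σ * (tw i)⁻¹), (cls i', σ * (tw i')⁻¹)] b := by
    intro a b hab
    fin_cases a <;> fin_cases b <;> simp_all
  ext τ
  have h := (card_image_pair_inter_eq_one_iff hinj _).1 (hbal (σ * τ⁻¹))
  simp only [Matrix.cons_val_zero, Matrix.cons_val_one, Matrix.cons_val_fin_one, prodTypeSet,
    mem_filter, mem_univ, true_and] at h
  rw [← Finset.inv_smul_mem_iff, ← Finset.inv_smul_mem_iff] at h
  simp only [smul_eq_mul, mul_inv_rev, inv_inv, mul_assoc, inv_mul_cancel_left] at h
  rw [mem_compl, mem_corner, mem_corner]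
  exact ⟨fun h1 h2 => (h.1 h2) h1, fun h1 => by_contra fun h2 => h1 (h.2 h2)⟩

omit [Fintype ι] [DecidableEq ι] in
/-- **The reduced line of a face is exceptional on `B_red`** (`k ≥ 1`): if no two corners are
complementary, the wedge of the reduced set `U_σ` is not a `k`-fold product of divisor classes of the
reduced product. -/
theorem coordWedgeOn_reducedEnum_notMem_divisorPowerIn {k : ℕ} (hk : 0 < k) (e : Fin (2 * k) ≃ ι)
    (Φ : J → Finset G) {cls : ι → J} {tw : ι → G} (hinj : Function.Injective fun i => (cls i, tw i))
    (hnc : ∀ i i', corner Φ cls tw i' ≠ (corner Φ cls tw i)ᶜ) (σ : G) :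
    coordWedgeOn (2 * k) (reducedEnum cls tw e σ) ∉
      divisorPowerIn (fun g : G => prodTypeSet fun j => g • Φ j) k := by
  intro h
  obtain ⟨s, hs, hrange⟩ := exists_isBalancedPairing_of_mem_divisorPowerIn _
    (reducedEnum_injective hinj e σ) h
  -- the first pair lies in `U_σ`, so it is `{(cls i, σ tw_i⁻¹), (cls i', σ tw_{i'}⁻¹)}`
  have hmem : ∀ b, ∃ i, reducedEnum cls tw e σ (e.symm i) = s ⟨0, hk⟩ b := by
    intro b
    have : s ⟨0, hk⟩ b ∈ Set.range (reducedEnum cls tw e σ) := by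
      rw [← hrange]
      exact (mem_range_concatPairs s _).2 ⟨⟨0, hk⟩, b, rfl⟩
    obtain ⟨a, ha⟩ := this
    exact ⟨e a, by rw [Equiv.symm_apply_apply]; exact ha⟩
  obtain ⟨i, hi⟩ := hmem 0
  obtain ⟨i', hi'⟩ := hmem 1
  simp only [reducedEnum_apply, Equiv.apply_symm_apply] at hi hi'
  have hpair : (fun b : Fin 2 => ![(cls i, σ * (tw i)⁻¹), (cls i', σ * (tw i')⁻¹)] b) = s ⟨0, hk⟩ := by
    funext b
    fin_cases b
    · exact hi
    · exact hi'
  have hne : (cls i, σ * (tw i)⁻¹) ≠ (cls i', σ * (tw i')⁻¹) := by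
    intro h0
    have := (hs ⟨0, hk⟩).1 (a₁ := 0) (a₂ := 1) (by rw [← hi, ← hi']; exact h0)
    exact absurd this (by decide)
  refine hnc i i' (eq_compl_of_balanced_pair_reduced Φ cls tw σ hne fun g => ?_)
  rw [hpair]
  exact (hs ⟨0, hk⟩).2 g

end Reduced

/-! ### The faces: the reduced lines of every face record are exceptional on `B_red` -/

section Faces

variable {G : Type*} [Group G] [DecidableEq G] [Fintype G]

/-- **The reduced lines of a rank-four face are exceptional on `B_red`**: for a face record passing its
checks (`D.Ok c`: the corners are `reps (cls i) · tw i`, the pairs `(cls i, tw i)` distinct, …) in degree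
`> 4`, the wedge of the reduced set `U_σ` (the class Lemma R hands to C5′) is not a product of two divisor
classes of the reduced product `∏_j Simple (reps j)`. -/
theorem FaceData.reduced_exceptional {c : G} (hc : IsComplexConj c) (D : FaceData G) (hok : D.Ok c)
    (h4 : 4 < Fintype.card G) (σ : G) :
    coordWedgeOn (2 * 2) (reducedEnum D.cls D.tw (Equiv.refl (Fin (2 * 2))) σ) ∉
      divisorPowerIn (fun g : G => prodTypeSet fun j => g • D.reps j) 2 := by
  refine coordWedgeOn_reducedEnum_notMem_divisorPowerIn (by norm_num) _ D.reps hok.2.2.2.2.2 ?_ σ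
  intro i i'
  rw [← hok.2.2.2.1]
  exact faceCorners_ne_compl hc hok.1 hok.2.2.1 h4 i i'

end Faces

end HodgeRepro.RouteC
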